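import Literature.AlgebraicGeometry.HodgeTheory.MonodromyMumfordTateHeredityCurves
import Literature.AlgebraicGeometry.HodgeTheory.HodgeGenericPointsComeagreQP
import HarnessLib

/-!
# Heredity off a MEAGRE set for every smooth projective family (unconditional): «a finite-index subgroup of the
# monodromy group lies in the Mumford–Tate group» at ONE member of an algebraic sub-family of ANY dimension ⇒ the same
# off a meagre subset of the sub-family (CMSP (15.7) + Deligne 1972 Prop. 7.5 in André's analytic form + Griffiths'
# holomorphy, now a tree theorem; NO Cattani–Deligne–Kaplan)

Family `hodge`, layer `Literature/AlgebraicGeometry/HodgeTheory`. THEOREMS only (no definition, no named fact). Written by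
the prover seat `hodge-nonav-prover-Ax` (g16, cell `hodge-nonav`), programme «HEREDITY» (the any-dimension companion of
`MonodromyMumfordTateHeredityCurves`: over a curve the exceptional set is countable, over a higher-dimensional sub-family it
is meagre).

SETTING as in `MonodromyMumfordTateHeredityCurves`: `π : 𝒳 ⟶ S` smooth projective with `𝒳`, `S` quasi-projective, `S` smooth;
FI(t) := «some finite-index subgroup of `Γ_t` lies in `MT(Hᵏ(X_t))(ℚ)`»; `P` smooth quasi-projective of relative dimension `d`
with `P(ℂ)` path connected; `g : P ⟶ S`.

* `exists_isMeagre_finiteIndex_le_mumfordTateGroup_of_baseChange` — FI(g c₀) for ONE `c₀` ⇒ a MEAGRE `M ⊆ P(ℂ)` with FI(g c)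
  for every `c ∉ M`: the non-Hodge-generic points of the pulled-back family `π' = 𝒳 ×_S P → P` are meagre
  (`exists_isMeagre_isHodgeGenericPoint_of_griffiths1968QP` at `griffiths1968_holomorphicHodgeSubbundlesQP_holds`), transports
  of `π'` exist along paths, and HEREDITY H1 (`exists_finiteIndex_le_mumfordTateGroup_map_of_isHodgeGenericPoint_familyPullback`).
* `glIdentityComponent_subset_mumfordTateGroup_offMeagre_of_baseChange` — identity-component currency.

So the FI-exceptional locus of `π` is MEAGRE IN EVERY smooth algebraic sub-family through an FI point — not only in the whole
base (where André's Baire argument gives it directly) and not only in Lefschetz-generic sub-families. HONEST FRAMING: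
unconditional, structural; `M` unspecified; FI at the seed a hypothesis; no statement about the Hodge conjecture; the
Cattani–Deligne–Kaplan floor (ALGEBRAIC exceptional sets) untouched.

## References
* [CarlsonMullerStachPeters2017] J. Carlson, S. Müller-Stach, C. Peters, *Period Mappings and Period Domains*, 2nd ed.,
  §15.3 (15.7), Lemma–Definition 15.3.7.
* [Deligne1972WeilK3] P. Deligne, La conjecture de Weil pour les surfaces K3, Invent. Math. 15 (1972), Prop. 7.5.
* [Andre1992] Y. André, Mumford–Tate groups of mixed Hodge structures…, Compositio Math. 82 (1992), §4 Lemma 4.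
* [Griffiths1968PeriodsII] P. Griffiths, Periods of integrals on algebraic manifolds II, Amer. J. Math. 90 (1968), Thm. 1.1.
-/

noncomputable section

namespace Literature.AlgebraicGeometry.HodgeTheory

open CategoryTheory _root_.AlgebraicGeometry
open _root_.Topology
open Literature.AlgebraicGeometry.Motives
open Literature.AlgebraicTopology.SingularHomology

variable [HodgeTensorFacts.{0, 0}] {𝒳 S P : SchemeOver ℂ} (π : 𝒳 ⟶ S) (n k : ℕ)
  (hf : IsSmoothProjectiveFamily π n) (hS : IsQuasiProjectiveOver S) (hSs : Smooth S.hom)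
  (A : ∀ t : ComplexPoints S, HodgeModel n (fiberOver π t)) (hA : ∀ t, (A t).IsHodgeSymmetric)
  [∀ t : ComplexPoints S, Module.Finite ℚ (singularCohomology ℚ ℚ (ComplexPoints (fiberOver π t)) k)]
  [PathConnectedSpace (ComplexPoints P)] (g : P ⟶ S)

/-- **HEREDITY OFF A MEAGRE SET, for every smooth projective family and every smooth algebraic sub-family** (unconditional).
`π : 𝒳 ⟶ S` smooth projective with `𝒳`, `S` quasi-projective, `S` smooth; `P` smooth quasi-projective of relative dimension `d`
with `P(ℂ)` path connected; `g : P ⟶ S`. If at ONE point `c₀` some finite-index subgroup of the monodromy group `Γ_{g c₀}` of `π`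
lies in `MT(Hᵏ(𝒳_{g c₀}))(ℚ)` (stated at `t₀ = g c₀`), then there is a MEAGRE `M ⊆ P(ℂ)` such that the same holds at `g c` for
every `c ∉ M`. [cite: CarlsonMullerStachPeters2017, §15.3 (15.7) and Lemma–Definition 15.3.7] [cite: Deligne1972WeilK3, Prop. 7.5]
[cite: Andre1992, §4 Lemma 4] [cite: Griffiths1968PeriodsII, Thm. 1.1] -/
theorem exists_isMeagre_finiteIndex_le_mumfordTateGroup_of_baseChange (h𝒳 : IsQuasiProjectiveOver 𝒳)
    (d : ℕ) [SmoothOfRelativeDimension d P.hom] (hPq : IsQuasiProjectiveOver P) (c₀ : ComplexPoints P) (t₀ : ComplexPoints S) (ht₀ : AlgPoints.map g c₀ = t₀)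
    (hFI : letI hU := isCohomologicallyLocallyTrivialOn_univ_of_isQuasiProjectiveOver π hf hS hSs
      ∃ Γ₀ : Subgroup (singularCohomology ℚ ℚ (ComplexPoints (fiberOver π t₀)) k ≃ₗ[ℚ]
          singularCohomology ℚ ℚ (ComplexPoints (fiberOver π t₀)) k),
        Γ₀ ≤ ratMonodromyGroup π k hU ⟨t₀, Set.mem_univ _⟩ ∧
        (Γ₀.subgroupOf (ratMonodromyGroup π k hU ⟨t₀, Set.mem_univ _⟩)).FiniteIndex ∧
        Γ₀ ≤ ((A t₀).hodgeStructure (hf.isSmoothProjective t₀) (hA t₀) k).mumfordTateGroup) :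
    letI hU := isCohomologicallyLocallyTrivialOn_univ_of_isQuasiProjectiveOver π hf hS hSs
    ∃ M : Set (ComplexPoints P), IsMeagre M ∧ ∀ c : ComplexPoints P, c ∉ M →
      ∃ Γ₁ : Subgroup (singularCohomology ℚ ℚ (ComplexPoints (fiberOver π (AlgPoints.map g c))) k ≃ₗ[ℚ]
          singularCohomology ℚ ℚ (ComplexPoints (fiberOver π (AlgPoints.map g c))) k),
        Γ₁ ≤ ratMonodromyGroup π k hU ⟨AlgPoints.map g c, Set.mem_univ _⟩ ∧
        (Γ₁.subgroupOf (ratMonodromyGroup π k hU ⟨AlgPoints.map g c, Set.mem_univ _⟩)).FiniteIndex ∧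
        Γ₁ ≤ ((A (AlgPoints.map g c)).hodgeStructure (hf.isSmoothProjective (AlgPoints.map g c))
          (hA (AlgPoints.map g c)) k).mumfordTateGroup := by
  subst ht₀
  have hU := isCohomologicallyLocallyTrivialOn_univ_of_isQuasiProjectiveOver π hf hS hSs
  haveI := hSs
  haveI : IsSeparated S.hom := hS.isVarietyPair_ofScheme.isSeparated
  haveI hPs : Smooth P.hom := SmoothOfRelativeDimension.smooth d _
  -- ### the pulled-back family over `P`
  have hf' : IsSmoothProjectiveFamily (familyPullback.snd π g) n := hf.familyPullback_snd g
  have hU' := isCohomologicallyLocallyTrivialOn_univ_of_isQuasiProjectiveOver (familyPullback.snd π g) hf' hPq inferInstance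
  have h𝒳' : IsQuasiProjectiveOver (familyPullback π g) := isQuasiProjectiveOver_familyPullback_of_isSeparated π g h𝒳 hPq
  haveI : ∀ c : ComplexPoints P, Module.Finite ℚ (singularCohomology ℚ ℚ (ComplexPoints (fiberOver (familyPullback.snd π g) c)) k) :=
    fun c => BettiUniverse.finite (hf'.isSmoothProjective c) k
  have hAm' := fun c : ComplexPoints P => exists_isReal_hodgeModel_holds.exists_isHodgeSymmetric (hf'.isSmoothProjective c)
  let A' : ∀ c : ComplexPoints P, HodgeModel n (fiberOver (familyPullback.snd π g) c) := fun c => (hAm' c).choose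
  have hA' : ∀ c, (A' c).IsHodgeSymmetric := fun c => (hAm' c).choose_spec
  -- ### Deligne ∕ André (analytic form) with Griffiths (the cell's theorem): the non-generic points of `π'` are meagre
  obtain ⟨M, hM, hgen⟩ := exists_isMeagre_isHodgeGenericPoint_of_griffiths1968QP
    griffiths1968_holomorphicHodgeSubbundlesQP_holds (familyPullback.snd π g) n k d hf' hPq h𝒳' hU' A' hA'
  refine ⟨M, hM, fun c hc => ?_⟩
  have hgenc := hgen ⟨c, Set.mem_univ _⟩ hc
  -- ### a path `c ⇝ c₀` and the rational transport of `π'` along it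
  let γ : Path c c₀ := PathConnectedSpace.somePath c c₀
  let γ' : Path (⟨c, Set.mem_univ _⟩ : (Set.univ : Set (ComplexPoints P))) ⟨c₀, Set.mem_univ _⟩ :=
    γ.map (f := fun x : ComplexPoints P => (⟨x, Set.mem_univ x⟩ : (Set.univ : Set (ComplexPoints P))))
      (continuous_id.subtype_mk _)
  have hrat' : ∀ (s t : (Set.univ : Set (ComplexPoints P))) (δ : Path.Homotopic.Quotient s t)
      (α : complexBetti (fiberOver (familyPullback.snd π g) s.1) k),
      IsRationalClass α → IsRationalClass (transportFun (familyPullback.snd π g) k hU' δ α) :=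
    fun s t δ α hα => isRationalClass_transportFun_of_isSmoothProjectiveFamily _ k d hf' hPq δ hα
  obtain ⟨T', hT'⟩ := exists_ratTransport (familyPullback.snd π g) k hU' hrat' ⟦γ'⟧
  -- ### HEREDITY H1
  exact exists_finiteIndex_le_mumfordTateGroup_map_of_isHodgeGenericPoint_familyPullback π g k hU hU' hf A hA A' hA' hgenc hT' hFI

/-- **Identity-component currency**: under the hypotheses of `exists_isMeagre_finiteIndex_le_mumfordTateGroup_of_baseChange`, off the
meagre `M` the identity component `(Γ_{g c}^Zar)°` of the monodromy group of `π` at `g c` lies in `MT(Hᵏ(𝒳_{g c}))(ℚ)`.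
[cite: CarlsonMullerStachPeters2017, Lemma–Definition 15.3.7] [cite: Deligne1972WeilK3, Prop. 7.5] -/
theorem glIdentityComponent_subset_mumfordTateGroup_offMeagre_of_baseChange (h𝒳 : IsQuasiProjectiveOver 𝒳)
    (d : ℕ) [SmoothOfRelativeDimension d P.hom] (hPq : IsQuasiProjectiveOver P) (c₀ : ComplexPoints P) (t₀ : ComplexPoints S) (ht₀ : AlgPoints.map g c₀ = t₀)
    (hFI : letI hU := isCohomologicallyLocallyTrivialOn_univ_of_isQuasiProjectiveOver π hf hS hSs
      ∃ Γ₀ : Subgroup (singularCohomology ℚ ℚ (ComplexPoints (fiberOver π t₀)) k ≃ₗ[ℚ]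
          singularCohomology ℚ ℚ (ComplexPoints (fiberOver π t₀)) k),
        Γ₀ ≤ ratMonodromyGroup π k hU ⟨t₀, Set.mem_univ _⟩ ∧
        (Γ₀.subgroupOf (ratMonodromyGroup π k hU ⟨t₀, Set.mem_univ _⟩)).FiniteIndex ∧
        Γ₀ ≤ ((A t₀).hodgeStructure (hf.isSmoothProjective t₀) (hA t₀) k).mumfordTateGroup) :
    letI hU := isCohomologicallyLocallyTrivialOn_univ_of_isQuasiProjectiveOver π hf hS hSs
    ∃ M : Set (ComplexPoints P), IsMeagre M ∧ ∀ c : ComplexPoints P, c ∉ M →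
      glIdentityComponent (ratMonodromyGroup π k hU ⟨AlgPoints.map g c, Set.mem_univ _⟩) ⊆
        (((A (AlgPoints.map g c)).hodgeStructure (hf.isSmoothProjective (AlgPoints.map g c))
            (hA (AlgPoints.map g c)) k).mumfordTateGroup : Set _) := by
  obtain ⟨M, hM, hC⟩ := exists_isMeagre_finiteIndex_le_mumfordTateGroup_of_baseChange π n k hf hS hSs A hA g h𝒳 d hPq c₀ t₀ ht₀ hFI
  refine ⟨M, hM, fun c hc => ?_⟩
  obtain ⟨Γ₁, hle, hfi, hMT⟩ := hC c hc
  exact (glIdentityComponent_subset_of_finiteIndex hle hfi).trans (glZariskiClosure_subset_mumfordTateGroup _ hMT)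

end Literature.AlgebraicGeometry.HodgeTheory

end
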